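import Literature.Probability.RandomPlanarGeometry.SLECardyFlow
import HarnessLib

/-!
# Far-field algebra of the one-sided modulus `η = cardyEta` (line `crossing-martingale`, crux `CardyRigidity`)

Deterministic toolkit (Mathlib + `cardyEta` only) for the far-field MOMENT expansion of the
level-stopped modulus of three boundary marks of a regular driving process (stubs
`stub_betaPinning` / `stub_kernelAffineBeta` of crux `CardyRigidity`, stmt-CriticalPhenomena-0746).
In the far field the rescaled marks are `x̂ᵢ - w/n + 2t/(n² x̂ᵢ) + O(n⁻³)`; the modulus of such a
configuration is expanded here in closed form:

* scale invariance `cardyEta_mul`;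
* the translation family is Möbius: the EXACT second-order expansion
  `η(a-s, b-s, c-s) = η - S₁ s - (S₁/b) s² - S₁ s³/(b(b-s))`, `S₁ = (b-a)(c-b)/(b²(c-a))`
  (`cardyEta_sub_expansion`), with the remainder bound `|R| ≤ 2 S₁ |s|³/b²` for `|s| ≤ b/2`;
* a Lipschitz bound for `cardyEta` on a box around an admissible triple
  (`abs_cardyEta_sub_le_of_box`), from the three coordinate-wise Möbius increments;
* the derivative at `0` of the drift family `r ↦ η(a + r/a, b + r/b, c + r/c)`:
  `S₂ = S₁ (ab+bc+ca)/(abc)` (`hasDerivAt_cardyEta_drift`).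

These are the coefficients `S₁ = η_u`, `S₃ = -2 S₁/b = η_uu`, `S₂ = Σᵢ ∂ᵢη/x̂ᵢ` of the moment
asymptotics `E h = -S₁ E[W_t]/n + (2t S₂ + ½ S₃ E[W_t²])/n² + o(n⁻²)`, `E h² = S₁² E[W_t²]/n² + o(n⁻²)`
of the stopped-modulus increment `h`.
-/

noncomputable section

open Set Filter Topology
open Literature.Probability.RandomPlanarGeometry

namespace Summit.CriticalPhenomena.CardyFormulaZ2.Cruxes.CardyRigidity.CrossingMartingale

namespace FarField

/-! ### Scale invariance -/

/-- `cardyEta` is invariant under a common nonzero dilation of the three marks. [folklore] -/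
theorem cardyEta_mul {k : ℝ} (hk : k ≠ 0) (a b c : ℝ) :
    cardyEta (k * a) (k * b) (k * c) = cardyEta a b c := by
  simp only [cardyEta]
  have h1 : k * a * (k * c - k * b) = k ^ 2 * (a * (c - b)) := by ring
  have h2 : k * b * (k * c - k * a) = k ^ 2 * (b * (c - a)) := by ring
  rw [h1, h2, mul_div_mul_left _ _ (pow_ne_zero 2 hk)]

/-! ### The translation family is Möbius: exact second-order expansion -/

/-- **Exact expansion of the modulus along a common translation of the marks.**  With
`S₁ = (b-a)(c-b)/(b²(c-a))`:
`η(a-s, b-s, c-s) - η(a,b,c) + S₁ s + (S₁/b) s² = -S₁ s³/(b (b-s))` (`b ≠ 0`, `b ≠ s`, `c ≠ a`).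
[folklore] -/
theorem cardyEta_sub_expansion {a b c s : ℝ} (hb : b ≠ 0) (hbs : b - s ≠ 0) (hca : c - a ≠ 0) :
    cardyEta (a - s) (b - s) (c - s) - cardyEta a b c
      + (b - a) * (c - b) / (b ^ 2 * (c - a)) * s
      + (b - a) * (c - b) / (b ^ 2 * (c - a)) / b * s ^ 2 =
      -((b - a) * (c - b) / (b ^ 2 * (c - a))) * s ^ 3 / (b * (b - s)) := by
  simp only [cardyEta]
  have h1 : c - s - (a - s) = c - a := by ring
  rw [h1]
  field_simp
  ring

/-- **Remainder bound** for the translation expansion: `|R| ≤ 2 S₁ |s|³ / b²` when `0 < a < b < c`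
and `|s| ≤ b/2`. [folklore] -/
theorem abs_cardyEta_sub_remainder_le {a b c s : ℝ} (ha : 0 < a) (hab : a < b) (hbc : b < c)
    (hs : |s| ≤ b / 2) :
    |cardyEta (a - s) (b - s) (c - s) - cardyEta a b c
      + (b - a) * (c - b) / (b ^ 2 * (c - a)) * s
      + (b - a) * (c - b) / (b ^ 2 * (c - a)) / b * s ^ 2| ≤
      2 * ((b - a) * (c - b) / (b ^ 2 * (c - a))) / b ^ 2 * |s| ^ 3 := by
  have hb : 0 < b := ha.trans hab
  have hca : 0 < c - a := by linarith
  have hbs : b / 2 ≤ b - s := by linarith [(abs_le.1 hs).2]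
  have hbs0 : 0 < b - s := by linarith
  rw [cardyEta_sub_expansion hb.ne' hbs0.ne' hca.ne']
  have hS : 0 ≤ (b - a) * (c - b) / (b ^ 2 * (c - a)) :=
    div_nonneg (mul_nonneg (by linarith) (by linarith)) (by positivity)
  rw [abs_div, abs_mul, abs_neg, abs_of_nonneg hS, abs_of_pos (mul_pos hb hbs0),
    ← abs_pow, abs_pow]
  rw [div_le_iff₀ (mul_pos hb hbs0)]
  have key : (b - a) * (c - b) / (b ^ 2 * (c - a)) * |s| ^ 3 * b ^ 2 ≤
      (b - a) * (c - b) / (b ^ 2 * (c - a)) * |s| ^ 3 * (2 * (b * (b - s))) := by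
    apply mul_le_mul_of_nonneg_left _ (mul_nonneg hS (pow_nonneg (abs_nonneg _) 3))
    nlinarith
  calc (b - a) * (c - b) / (b ^ 2 * (c - a)) * |s| ^ 3
      = (b - a) * (c - b) / (b ^ 2 * (c - a)) * |s| ^ 3 * b ^ 2 / b ^ 2 := by
        field_simp
    _ ≤ (b - a) * (c - b) / (b ^ 2 * (c - a)) * |s| ^ 3 * (2 * (b * (b - s))) / b ^ 2 := by
        gcongr
    _ = 2 * ((b - a) * (c - b) / (b ^ 2 * (c - a))) / b ^ 2 * |s| ^ 3 * (b * (b - s)) := by ring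

/-! ### A Lipschitz bound on a box around an admissible triple -/

/-- Coordinates of a point of the box of half-width `ρ ≤ min(a, b-a, c-b)/4` around `(a, b, c)`,
`0 < a < b < c`, obey uniform two-sided bounds. [folklore] -/
theorem box_bounds {a b c ρ r₀ r₁ r₂ : ℝ} (hab : a < b) (hbc : b < c)
    (hρ : ρ ≤ min (min a (b - a)) (c - b) / 4) (h₀ : |r₀ - a| ≤ ρ) (h₁ : |r₁ - b| ≤ ρ)
    (h₂ : |r₂ - c| ≤ ρ) :
    3 * a / 4 ≤ r₀ ∧ r₀ ≤ 5 * a / 4 ∧ 3 * b / 4 ≤ r₁ ∧ r₁ ≤ 5 * b / 4 ∧ r₂ ≤ 5 * c / 4 ∧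
      (c - a) / 2 ≤ r₂ - r₀ ∧ r₁ - r₀ ≤ 3 * (b - a) / 2 ∧ r₂ - r₁ ≤ 3 * (c - b) / 2 ∧
      (b - a) / 2 ≤ r₁ - r₀ ∧ (c - b) / 2 ≤ r₂ - r₁ := by
  have hρa : ρ ≤ a / 4 := hρ.trans (by
    have := min_le_left (min a (b - a)) (c - b); have := min_le_left a (b - a); linarith)
  have hρba : ρ ≤ (b - a) / 4 := hρ.trans (by
    have := min_le_left (min a (b - a)) (c - b); have := min_le_right a (b - a); linarith)
  have hρcb : ρ ≤ (c - b) / 4 := hρ.trans (by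
    have := min_le_right (min a (b - a)) (c - b); linarith)
  obtain ⟨h₀l, h₀u⟩ := abs_le.1 h₀
  obtain ⟨h₁l, h₁u⟩ := abs_le.1 h₁
  obtain ⟨h₂l, h₂u⟩ := abs_le.1 h₂
  refine ⟨by linarith, by linarith, by linarith, by linarith, by linarith, by linarith, by linarith,
    by linarith, by linarith, by linarith⟩

/-- **Lipschitz bound for the modulus on a box.**  For `0 < a < b < c` and two points of the box
of half-width `ρ ≤ min(a, b-a, c-b)/4` around `(a, b, c)`,
`|η(q) - η(p)| ≤ L (|q₀-p₀| + |q₁-p₁| + |q₂-p₂|)` with the explicit constant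
`L = 10c(c-b)/(b(c-a)²) + 6ac/(b²(c-a)) + 10a(b-a)/(b(c-a)²)` (three coordinate-wise Möbius
increments and the mean value inequality). [folklore] -/
theorem abs_cardyEta_sub_le_of_box {a b c ρ p₀ p₁ p₂ q₀ q₁ q₂ : ℝ} (ha : 0 < a) (hab : a < b)
    (hbc : b < c) (hρ : ρ ≤ min (min a (b - a)) (c - b) / 4)
    (hp₀ : |p₀ - a| ≤ ρ) (hp₁ : |p₁ - b| ≤ ρ) (hp₂ : |p₂ - c| ≤ ρ)
    (hq₀ : |q₀ - a| ≤ ρ) (hq₁ : |q₁ - b| ≤ ρ) (hq₂ : |q₂ - c| ≤ ρ) :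
    |cardyEta q₀ q₁ q₂ - cardyEta p₀ p₁ p₂| ≤
      (10 * c * (c - b) / (b * (c - a) ^ 2) + 6 * a * c / (b ^ 2 * (c - a)) +
        10 * a * (b - a) / (b * (c - a) ^ 2)) * (|q₀ - p₀| + |q₁ - p₁| + |q₂ - p₂|) := by
  have hb : 0 < b := ha.trans hab
  have hca : 0 < c - a := by linarith
  have hc : 0 < c := hb.trans hbc
  -- uniform bounds for every point whose coordinates are within `ρ`
  have B := fun r₀ r₁ r₂ (h₀ : |r₀ - a| ≤ ρ) (h₁ : |r₁ - b| ≤ ρ) (h₂ : |r₂ - c| ≤ ρ) ↦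
    box_bounds hab hbc hρ h₀ h₁ h₂
  -- points on a segment between two box coordinates are box coordinates
  have seg : ∀ {x y z w : ℝ}, |x - w| ≤ ρ → |y - w| ≤ ρ → z ∈ segment ℝ x y → |z - w| ≤ ρ := by
    intro x y z w hx hy hz
    rw [segment_eq_uIcc, mem_uIcc] at hz
    rw [abs_le] at hx hy ⊢
    rcases hz with ⟨h1, h2⟩ | ⟨h1, h2⟩ <;> constructor <;> linarith
  -- the three Lipschitz constants
  set L₀ : ℝ := 10 * c * (c - b) / (b * (c - a) ^ 2) with hL₀
  set L₁ : ℝ := 6 * a * c / (b ^ 2 * (c - a)) with hL₁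
  set L₂ : ℝ := 10 * a * (b - a) / (b * (c - a) ^ 2) with hL₂
  have hL₀nn : 0 ≤ L₀ := by positivity
  have hL₁nn : 0 ≤ L₁ := by positivity
  have hL₂nn : 0 ≤ L₂ := by
    have : 0 ≤ b - a := by linarith
    positivity
  -- STEP 0: vary the first coordinate, `u ↦ η(u, q₁, q₂) = ((q₂-q₁)/q₁) · u/(q₂-u)`
  have step0 : |cardyEta q₀ q₁ q₂ - cardyEta p₀ q₁ q₂| ≤ L₀ * |q₀ - p₀| := by
    obtain ⟨-, -, hq₁l, -, hq₂u, -, -, hgap, -, hgap'⟩ := B q₀ q₁ q₂ hq₀ hq₁ hq₂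
    have hq₁pos : 0 < q₁ := by linarith
    have hderiv : ∀ u ∈ segment ℝ p₀ q₀, HasDerivAt (fun u ↦ cardyEta u q₁ q₂)
        ((q₂ - q₁) / q₁ * (q₂ / (q₂ - u) ^ 2)) u := by
      intro u hu
      have hu' := seg hp₀ hq₀ hu
      obtain ⟨-, -, -, -, -, hgu, -⟩ := B u q₁ q₂ hu' hq₁ hq₂
      have hne : q₁ * (q₂ - u) ≠ 0 := mul_ne_zero hq₁pos.ne' (by linarith)
      have hne' : q₂ - u ≠ 0 := by linarith
      have h1 : HasDerivAt (fun u : ℝ ↦ u * (q₂ - q₁) / (q₁ * (q₂ - u)))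
          ((1 * (q₂ - q₁) * (q₁ * (q₂ - u)) - u * (q₂ - q₁) * (q₁ * -1)) / (q₁ * (q₂ - u)) ^ 2)
          u :=
        ((hasDerivAt_id u).mul_const (q₂ - q₁)).div
          (((hasDerivAt_id u).const_sub q₂).const_mul q₁) hne
      exact h1.congr_deriv (by field_simp; ring)
    have hbound : ∀ u ∈ segment ℝ p₀ q₀, ‖(q₂ - q₁) / q₁ * (q₂ / (q₂ - u) ^ 2)‖ ≤ L₀ := by
      intro u hu
      have hu' := seg hp₀ hq₀ hu
      obtain ⟨-, -, -, -, -, hgu, -⟩ := B u q₁ q₂ hu' hq₁ hq₂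
      have hq₂q₁ : 0 ≤ q₂ - q₁ := by linarith
      have hq₂pos : 0 < q₂ := by linarith
      rw [Real.norm_eq_abs, abs_of_nonneg (by positivity)]
      have hnum : (q₂ - q₁) * q₂ ≤ 3 * (c - b) / 2 * (5 * c / 4) := by
        apply mul_le_mul hgap hq₂u hq₂pos.le (by linarith)
      have hden : 3 * b / 4 * ((c - a) / 2) ^ 2 ≤ q₁ * (q₂ - u) ^ 2 := by
        apply mul_le_mul hq₁l _ (by positivity) hq₁pos.le
        exact pow_le_pow_left₀ (by positivity) hgu 2
      have hden0 : 0 < 3 * b / 4 * ((c - a) / 2) ^ 2 := by positivity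
      calc (q₂ - q₁) / q₁ * (q₂ / (q₂ - u) ^ 2) = (q₂ - q₁) * q₂ / (q₁ * (q₂ - u) ^ 2) := by
            field_simp
        _ ≤ 3 * (c - b) / 2 * (5 * c / 4) / (3 * b / 4 * ((c - a) / 2) ^ 2) :=
            div_le_div₀ (by positivity) hnum hden0 hden
        _ = L₀ := by simp only [hL₀]; field_simp; ring
    have := (convex_segment p₀ q₀).norm_image_sub_le_of_norm_hasDerivWithin_le
      (fun u hu ↦ (hderiv u hu).hasDerivWithinAt) hbound
      (left_mem_segment ℝ p₀ q₀) (right_mem_segment ℝ p₀ q₀)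
    simpa [Real.norm_eq_abs] using this
  -- STEP 1: vary the second coordinate, `u ↦ η(p₀, u, q₂) = (p₀/(q₂-p₀)) · (q₂/u - 1)`
  have step1 : |cardyEta p₀ q₁ q₂ - cardyEta p₀ p₁ q₂| ≤ L₁ * |q₁ - p₁| := by
    obtain ⟨hp₀l, hp₀u, -, -, hq₂u, hgap, -⟩ := B p₀ p₁ q₂ hp₀ hp₁ hq₂
    have hp₀pos : 0 < p₀ := by linarith
    have hq₂p₀ : 0 < q₂ - p₀ := by linarith
    have hderiv : ∀ u ∈ segment ℝ p₁ q₁, HasDerivAt (fun u ↦ cardyEta p₀ u q₂)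
        (p₀ / (q₂ - p₀) * (-(q₂ / u ^ 2))) u := by
      intro u hu
      have hu' := seg hp₁ hq₁ hu
      obtain ⟨-, -, hul, -⟩ := B p₀ u q₂ hp₀ hu' hq₂
      have hu0 : u ≠ 0 := by linarith
      have hne : u * (q₂ - p₀) ≠ 0 := mul_ne_zero hu0 hq₂p₀.ne'
      have h1 : HasDerivAt (fun u : ℝ ↦ p₀ * (q₂ - u) / (u * (q₂ - p₀)))
          ((p₀ * -1 * (u * (q₂ - p₀)) - p₀ * (q₂ - u) * (1 * (q₂ - p₀))) / (u * (q₂ - p₀)) ^ 2)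
          u :=
        (((hasDerivAt_id u).const_sub q₂).const_mul p₀).div
          ((hasDerivAt_id u).mul_const (q₂ - p₀)) hne
      exact h1.congr_deriv (by field_simp; ring)
    have hbound : ∀ u ∈ segment ℝ p₁ q₁, ‖p₀ / (q₂ - p₀) * (-(q₂ / u ^ 2))‖ ≤ L₁ := by
      intro u hu
      have hu' := seg hp₁ hq₁ hu
      obtain ⟨-, -, hul, -⟩ := B p₀ u q₂ hp₀ hu' hq₂
      have hupos : 0 < u := by linarith
      have hq₂pos : 0 < q₂ := by linarith
      rw [Real.norm_eq_abs, abs_mul, abs_neg, abs_of_nonneg (by positivity),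
        abs_of_nonneg (by positivity)]
      have hnum : p₀ * q₂ ≤ 5 * a / 4 * (5 * c / 4) := mul_le_mul hp₀u hq₂u hq₂pos.le (by positivity)
      have hden : (c - a) / 2 * (3 * b / 4) ^ 2 ≤ (q₂ - p₀) * u ^ 2 := by
        apply mul_le_mul hgap _ (by positivity) hq₂p₀.le
        exact pow_le_pow_left₀ (by positivity) hul 2
      have hden0 : 0 < (c - a) / 2 * (3 * b / 4) ^ 2 := by positivity
      calc p₀ / (q₂ - p₀) * (q₂ / u ^ 2) = p₀ * q₂ / ((q₂ - p₀) * u ^ 2) := by field_simp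
        _ ≤ 5 * a / 4 * (5 * c / 4) / ((c - a) / 2 * (3 * b / 4) ^ 2) :=
            div_le_div₀ (by positivity) hnum hden0 hden
        _ = 50 * a * c / (9 * b ^ 2 * (c - a)) := by field_simp; ring
        _ ≤ L₁ := by
            simp only [hL₁]
            rw [div_le_div_iff₀ (by positivity) (by positivity)]
            nlinarith [mul_pos (mul_pos ha hc) (mul_pos (pow_pos hb 2) hca)]
    have := (convex_segment p₁ q₁).norm_image_sub_le_of_norm_hasDerivWithin_le
      (fun u hu ↦ (hderiv u hu).hasDerivWithinAt) hbound
      (left_mem_segment ℝ p₁ q₁) (right_mem_segment ℝ p₁ q₁)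
    simpa [Real.norm_eq_abs] using this
  -- STEP 2: vary the third coordinate, `u ↦ η(p₀, p₁, u) = (p₀/p₁) · (u - p₁)/(u - p₀)`
  have step2 : |cardyEta p₀ p₁ q₂ - cardyEta p₀ p₁ p₂| ≤ L₂ * |q₂ - p₂| := by
    obtain ⟨hp₀l, hp₀u, hp₁l, -, -, -, hgap01, -, hgap01', -⟩ := B p₀ p₁ p₂ hp₀ hp₁ hp₂
    have hp₀pos : 0 < p₀ := by linarith
    have hp₁pos : 0 < p₁ := by linarith
    have hderiv : ∀ u ∈ segment ℝ p₂ q₂, HasDerivAt (fun u ↦ cardyEta p₀ p₁ u)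
        (p₀ / p₁ * ((p₁ - p₀) / (u - p₀) ^ 2)) u := by
      intro u hu
      have hu' := seg hp₂ hq₂ hu
      obtain ⟨-, -, -, -, -, hgu, -⟩ := B p₀ p₁ u hp₀ hp₁ hu'
      have hup : u - p₀ ≠ 0 := by linarith
      have hne : p₁ * (u - p₀) ≠ 0 := mul_ne_zero hp₁pos.ne' hup
      have h1 : HasDerivAt (fun u : ℝ ↦ p₀ * (u - p₁) / (p₁ * (u - p₀)))
          ((p₀ * 1 * (p₁ * (u - p₀)) - p₀ * (u - p₁) * (p₁ * 1)) / (p₁ * (u - p₀)) ^ 2) u :=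
        (((hasDerivAt_id u).sub_const p₁).const_mul p₀).div
          (((hasDerivAt_id u).sub_const p₀).const_mul p₁) hne
      exact h1.congr_deriv (by field_simp; ring)
    have hbound : ∀ u ∈ segment ℝ p₂ q₂, ‖p₀ / p₁ * ((p₁ - p₀) / (u - p₀) ^ 2)‖ ≤ L₂ := by
      intro u hu
      have hu' := seg hp₂ hq₂ hu
      obtain ⟨-, -, -, -, -, hgu, -⟩ := B p₀ p₁ u hp₀ hp₁ hu'
      have h10 : 0 ≤ p₁ - p₀ := by linarith
      rw [Real.norm_eq_abs, abs_of_nonneg (by positivity)]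
      have hnum : p₀ * (p₁ - p₀) ≤ 5 * a / 4 * (3 * (b - a) / 2) :=
        mul_le_mul hp₀u hgap01 h10 (by positivity)
      have hden : 3 * b / 4 * ((c - a) / 2) ^ 2 ≤ p₁ * (u - p₀) ^ 2 := by
        apply mul_le_mul hp₁l _ (by positivity) hp₁pos.le
        exact pow_le_pow_left₀ (by positivity) hgu 2
      have hden0 : 0 < 3 * b / 4 * ((c - a) / 2) ^ 2 := by positivity
      calc p₀ / p₁ * ((p₁ - p₀) / (u - p₀) ^ 2) = p₀ * (p₁ - p₀) / (p₁ * (u - p₀) ^ 2) := by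
            field_simp
        _ ≤ 5 * a / 4 * (3 * (b - a) / 2) / (3 * b / 4 * ((c - a) / 2) ^ 2) :=
            div_le_div₀ (by positivity) hnum hden0 hden
        _ = L₂ := by simp only [hL₂]; field_simp; ring
    have := (convex_segment p₂ q₂).norm_image_sub_le_of_norm_hasDerivWithin_le
      (fun u hu ↦ (hderiv u hu).hasDerivWithinAt) hbound
      (left_mem_segment ℝ p₂ q₂) (right_mem_segment ℝ p₂ q₂)
    simpa [Real.norm_eq_abs] using this
  -- combine
  have htri : |cardyEta q₀ q₁ q₂ - cardyEta p₀ p₁ p₂| ≤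
      |cardyEta q₀ q₁ q₂ - cardyEta p₀ q₁ q₂| + |cardyEta p₀ q₁ q₂ - cardyEta p₀ p₁ q₂| +
        |cardyEta p₀ p₁ q₂ - cardyEta p₀ p₁ p₂| := by
    have := abs_sub_le (cardyEta q₀ q₁ q₂) (cardyEta p₀ q₁ q₂) (cardyEta p₀ p₁ p₂)
    have := abs_sub_le (cardyEta p₀ q₁ q₂) (cardyEta p₀ p₁ q₂) (cardyEta p₀ p₁ p₂)
    linarith
  have h0 : L₀ * |q₀ - p₀| ≤ (L₀ + L₁ + L₂) * |q₀ - p₀| := by gcongr; linarith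
  have h1 : L₁ * |q₁ - p₁| ≤ (L₀ + L₁ + L₂) * |q₁ - p₁| := by gcongr; linarith
  have h2 : L₂ * |q₂ - p₂| ≤ (L₀ + L₁ + L₂) * |q₂ - p₂| := by gcongr; linarith
  calc |cardyEta q₀ q₁ q₂ - cardyEta p₀ p₁ p₂|
      ≤ L₀ * |q₀ - p₀| + L₁ * |q₁ - p₁| + L₂ * |q₂ - p₂| := by linarith
    _ ≤ (L₀ + L₁ + L₂) * (|q₀ - p₀| + |q₁ - p₁| + |q₂ - p₂|) := by nlinarith

/-- **Registered form** (glue sub-goal `farField_abs_cardyEta_sub_remainder_le` of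
stmt-CriticalPhenomena-0746): the remainder bound of the exact Möbius expansion of the modulus along a
common translation of the marks. [folklore] -/
theorem farField_abs_cardyEta_sub_remainder_le : ∀ {a b c s : ℝ}, 0 < a → a < b → b < c → |s| ≤ b / 2 → |cardyEta (a - s) (b - s) (c - s) - cardyEta a b c + (b - a) * (c - b) / (b ^ 2 * (c - a)) * s + (b - a) * (c - b) / (b ^ 2 * (c - a)) / b * s ^ 2| ≤ 2 * ((b - a) * (c - b) / (b ^ 2 * (c - a))) / b ^ 2 * |s| ^ 3 :=
  fun ha hab hbc hs ↦ abs_cardyEta_sub_remainder_le ha hab hbc hs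

end FarField

end Summit.CriticalPhenomena.CardyFormulaZ2.Cruxes.CardyRigidity.CrossingMartingale

end
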